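import Summits.CriticalPhenomena.PercolationContinuityZ3.Theorems.PercNearOneGluingNoHeavyLowerTailSahiLatinZeroBottomTwoBlockKit
import Summits.CriticalPhenomena.PercolationContinuityZ3.Theorems.PercNearOneGluingNoHeavyLowerTailSahiLatinZeroBottomTwoBlockCertAll

/-!
# `NoHeavyLowerTail` (crux stmt-CriticalPhenomena-4575), Sahi programme (prim-master-conj gen 52): **THE TWO-BLOCK ZERO-BOTTOM THEOREM** —
# `Ψ ≥ 0`, i.e. top-slice dominance with the sharp constant `3/2`, for TWO ARBITRARY prime/cut pairs on disjoint blocks, every dimension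

Support file (`--supports stmt-CriticalPhenomena-4575`; proofs only, kernel, standard axioms — the finite check `TwoBlock.phi36_nonneg` it uses is itself
kernel-checked by `decide` in `…TwoBlockCertChk*`).  Memo `run/shared/lean/prim/prim-l12/FROM-prim-master-conj-g52-ONE-BLOCK.md`
§5.  Nothing here asserts the crux, Kahn's conjecture or (C¼).

THE MATHEMATICS.  A TWO-BLOCK ZERO-BOTTOM INSTANCE on `[3]^{U ⊕ V}`: nested up-sets `S ⊆ S′ = S ⊔ B` of `[3]^U` and `R ⊆ R′ = R ⊔ C` of `[3]^V`
(ARBITRARY primes `P′ = S′×Ω`, `Q′ = Ω×R′` and ARBITRARY cuts `P = S×Ω`, `Q = Ω×R` on the two disjoint blocks) and an arbitrary up-set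
`F ⊇ P ∪ Q`.  THEOREM (`psi_nonneg_twoBlock`): `Ψ(F; P, B×Ω, Q, Ω×C) ≥ 0`; equivalently (`three_kappa_top_le_two_kappa_lowerStep_twoBlock`)
`3·κ(F, P′, Q′) ≤ 2·κ(F×[3], lower step (P ⊂ P′), lower step (Q ⊂ Q′))` — the lower-step form `4c₁ ≥ 3c₃` of prim-ineq-gen-4's sharp-constant
conjecture (C¼) on the WHOLE disjoint-support zero-bottom family (gen 49's conjecture; gens 49–51 proved sub-families: conjunctive, private cuts,
relaxed bridges, half-cores, small windows).  PROOF (the product version of the method of `…ZeroBottomOneBlock`): `Ψ = Σ_ρ psiD(ρ·0,ρ·1,ρ·2)`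
(`Psi_eq_sum_lperm`); a Latin index of the product is a pair of Latin indices of the blocks and the integrand is a function `psiA` of the
CONFIGURATION `cfg ρ` (block types of the three `U`-points and `V`-points, `F`-bits of the nine mixed points).  The machine-found certificate
(`TwoBlock.termsU/termsV` + two joint terms) is a nonnegative combination of 68 conditional-Harris terms, each with nonnegative Latin sum here:
`sum_certUw_nonneg`, `sum_certVw_nonneg` (conditional Harris inside one block given the other, `sum_lperm_condHarrisU/V`, with `K = S′` and `L` a union of co-fibres
of `F`) and `sum_termX1/X2_nonneg` (conditional Harris in the product, `sum_lperm_condHarris`).  By the 36-fold symmetrisation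
(`thirtysix_mul_sum_lperm`, `cfg_mul_cst2`) and the finite check `TwoBlock.phi36_nonneg`, `Σ_ρ (psiA − certSum)(cfg ρ) ≥ 0`, whence `Ψ ≥ 0`.
HONEST LABEL: shared primes (overlapping supports of `P′, Q′`), (C¼)/TOP₁ in general, FBP(d ≥ 5), Kahn OPEN. [this work]
-/

namespace Summit.CriticalPhenomena.PercolationContinuityZ3.Theorems.SahiLatin

open Finset

section twoblock
variable {U V : Type} [Fintype U] [DecidableEq U] [Fintype V] [DecidableEq V]
  (S B : Finset (Pt U)) (R C : Finset (Pt V)) (F : Finset (Pt (U ⊕ V)))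

set_option linter.unusedSectionVars false

/-! ## §1  The configuration of a Latin index -/

/-- Type code of a `U`-point: `2` on `S`, `1` on `B`, `0` elsewhere. [this work] -/
def utype (w : Pt U) : Fin 3 := if w ∈ S then 2 else if w ∈ B then 1 else 0

/-- Type code of a `V`-point: `2` on `R`, `1` on `C`, `0` elsewhere. [this work] -/
def vtype (η : Pt V) : Fin 3 := if η ∈ R then 2 else if η ∈ C then 1 else 0

/-- The configuration of `ρ`. [this work] -/
def cfg (ρ : LPerm (U ⊕ V)) : TwoBlock.Cfg :=
  (fun i => utype S B (lpt (rU ρ) i), fun j => vtype R C (lpt (rV ρ) j), fun i j => decide (mixPt ρ i j ∈ F))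

/-- Re-indexing `ρ` acts on its configuration. [this work] -/
theorem cfg_mul_cst2 (ρ : LPerm (U ⊕ V)) (σ τ : Equiv.Perm (Fin 3)) :
    cfg S B R C F (ρ * cst2 σ τ) = TwoBlock.act (cfg S B R C F ρ) σ τ := by
  unfold cfg TwoBlock.act
  simp only [lpt_rU_mul_cst2, lpt_rV_mul_cst2, mixPt_mul_cst2]
  rfl

/-- Admissibility of the configuration when `F ⊇ S×Ω ∪ Ω×R`. [this work] -/
theorem adm_cfg (hSF : (cylL S : Finset (Pt (U ⊕ V))) ⊆ F) (hRF : (cylR R : Finset (Pt (U ⊕ V))) ⊆ F) (ρ : LPerm (U ⊕ V)) :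
    TwoBlock.adm (cfg S B R C F ρ) = true := by
  simp only [TwoBlock.adm, cfg, decide_eq_true_eq]
  intro i j
  refine ⟨fun h => ?_, fun h => ?_⟩
  · have hS : lpt (rU ρ) i ∈ S := by
      by_contra hn
      unfold utype at h; rw [if_neg hn] at h
      split_ifs at h <;> exact absurd h (by decide)
    exact hSF (by unfold mixPt; rw [mem_cylL, fstPt_elim]; exact hS)
  · have hR : lpt (rV ρ) j ∈ R := by
      by_contra hn
      unfold vtype at h; rw [if_neg hn] at h
      split_ifs at h <;> exact absurd h (by decide)
    exact hRF (by unfold mixPt; rw [mem_cylR, sndPt_elim]; exact hR)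

/-! ## §2  Bridges between configuration indicators and set indicators -/

variable {S B} in
/-- `isS = [· ∈ S]`. [this work] -/
theorem isS_cfg (ρ : LPerm (U ⊕ V)) (i : Fin 3) : TwoBlock.isS (cfg S B R C F ρ) i = ind S (lpt (rU ρ) i) := by
  unfold TwoBlock.isS cfg utype
  by_cases h1 : lpt (rU ρ) i ∈ S <;> by_cases h2 : lpt (rU ρ) i ∈ B <;> simp [h1, h2]

variable {S B} in
/-- `isB = [· ∈ B]` (for `S ∩ B = ∅`). [this work] -/
theorem isB_cfg (hSB : Disjoint S B) (ρ : LPerm (U ⊕ V)) (i : Fin 3) : TwoBlock.isB (cfg S B R C F ρ) i = ind B (lpt (rU ρ) i) := by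
  unfold TwoBlock.isB cfg utype
  by_cases h1 : lpt (rU ρ) i ∈ S <;> by_cases h2 : lpt (rU ρ) i ∈ B <;> simp [h1, h2]
  exact absurd h2 (disjoint_left.1 hSB h1)

variable {S B} in
/-- `isSp = [· ∈ S ∪ B]`. [this work] -/
theorem isSp_cfg (ρ : LPerm (U ⊕ V)) (i : Fin 3) : TwoBlock.isSp (cfg S B R C F ρ) i = ind (S ∪ B) (lpt (rU ρ) i) := by
  unfold TwoBlock.isSp cfg utype
  by_cases h1 : lpt (rU ρ) i ∈ S <;> by_cases h2 : lpt (rU ρ) i ∈ B <;> simp [h1, h2]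

variable {R C} in
/-- `isR = [· ∈ R]`. [this work] -/
theorem isR_cfg (ρ : LPerm (U ⊕ V)) (j : Fin 3) : TwoBlock.isR (cfg S B R C F ρ) j = ind R (lpt (rV ρ) j) := by
  unfold TwoBlock.isR cfg vtype
  by_cases h1 : lpt (rV ρ) j ∈ R <;> by_cases h2 : lpt (rV ρ) j ∈ C <;> simp [h1, h2]

variable {R C} in
/-- `isC = [· ∈ C]` (for `R ∩ C = ∅`). [this work] -/
theorem isC_cfg (hRC : Disjoint R C) (ρ : LPerm (U ⊕ V)) (j : Fin 3) : TwoBlock.isC (cfg S B R C F ρ) j = ind C (lpt (rV ρ) j) := by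
  unfold TwoBlock.isC cfg vtype
  by_cases h1 : lpt (rV ρ) j ∈ R <;> by_cases h2 : lpt (rV ρ) j ∈ C <;> simp [h1, h2]
  exact absurd h2 (disjoint_left.1 hRC h1)

variable {R C} in
/-- `isRp = [· ∈ R ∪ C]`. [this work] -/
theorem isRp_cfg (ρ : LPerm (U ⊕ V)) (j : Fin 3) : TwoBlock.isRp (cfg S B R C F ρ) j = ind (R ∪ C) (lpt (rV ρ) j) := by
  unfold TwoBlock.isRp cfg vtype
  by_cases h1 : lpt (rV ρ) j ∈ R <;> by_cases h2 : lpt (rV ρ) j ∈ C <;> simp [h1, h2]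

/-- `fF i j = [mixed point (i,j) ∈ F]`. [this work] -/
theorem fF_cfg (ρ : LPerm (U ⊕ V)) (i j : Fin 3) : TwoBlock.fF (cfg S B R C F ρ) i j = ind F (mixPt ρ i j) := by
  unfold TwoBlock.fF TwoBlock.bi cfg
  by_cases h : mixPt ρ i j ∈ F <;> simp [h]

/-- `ind` of a left cylinder at a point of `ρ`. [this work] -/
theorem ind_cylL_lpt (X : Finset (Pt U)) (ρ : LPerm (U ⊕ V)) (k : Fin 3) :
    ind (cylL X : Finset (Pt (U ⊕ V))) (lpt ρ k) = ind X (lpt (rU ρ) k) := by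
  rw [ind_cylL, lpt_eq_elim, fstPt_elim]

/-- `ind` of a right cylinder at a point of `ρ`. [this work] -/
theorem ind_cylR_lpt (Y : Finset (Pt V)) (ρ : LPerm (U ⊕ V)) (k : Fin 3) :
    ind (cylR Y : Finset (Pt (U ⊕ V))) (lpt ρ k) = ind Y (lpt (rV ρ) k) := by
  rw [ind_cylR, lpt_eq_elim, sndPt_elim]

/-- **The `Ψ`-integrand is `psiA` of the configuration.** [this work] -/
theorem psiA_cfg (hSB : Disjoint S B) (hRC : Disjoint R C) (ρ : LPerm (U ⊕ V)) :
    TwoBlock.psiA (cfg S B R C F ρ) =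
      psiD F (cylL S : Finset (Pt (U ⊕ V))) (cylL B) (cylR R) (cylR C) (lpt ρ 0) (lpt ρ 1) (lpt ρ 2) := by
  unfold TwoBlock.psiA psiD
  simp only [isS_cfg, isB_cfg R C F hSB, isR_cfg, isC_cfg S B F hRC, fF_cfg, mixPt_diag, ind_cylL_lpt, ind_cylR_lpt]

/-! ## §3  The conditional-Harris terms have nonnegative Latin sums -/

/-- Co-fibre of `H` over a point of the FIRST block: `{η : (w, η) ∈ H}`. [this work] -/
def cofibV (H : Finset (Pt (U ⊕ V))) (w : Pt U) : Finset (Pt V) := univ.filter fun η => Sum.elim w η ∈ H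

omit [DecidableEq U] in
/-- Membership in `cofibV`. [this work] -/
@[simp] theorem mem_cofibV {H : Finset (Pt (U ⊕ V))} {w : Pt U} {η : Pt V} : η ∈ cofibV H w ↔ Sum.elim w η ∈ H := by
  simp [cofibV]

omit [DecidableEq U] in
/-- `cofibV` of an up-set is an up-set. [this work] -/
theorem isUpperSet_cofibV {H : Finset (Pt (U ⊕ V))} (hH : IsUpperSet (H : Set (Pt (U ⊕ V)))) (w : Pt U) :
    IsUpperSet ((cofibV H w : Finset (Pt V)) : Set (Pt V)) := by
  intro η η' hle hη
  rw [mem_coe, mem_cofibV] at hη ⊢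
  exact hH (elim_le_elim_iff.2 ⟨le_rfl, hle⟩) hη

/-- The set `L` of a specification, as a function of the `V`-component. [this work] -/
def LsetU (L : TwoBlock.LSpec) (b : LPerm V) : Finset (Pt U) :=
  cofib F (lpt b L.j) ∪ (match L.k with
    | none => ∅
    | some k => if L.cap then (S ∪ B) ∩ cofib F (lpt b k) else cofib F (lpt b k))

/-- The set `L` of a specification, as a function of the `U`-component (roles swapped). [this work] -/
def LsetV (L : TwoBlock.LSpec) (a : LPerm U) : Finset (Pt V) :=
  cofibV F (lpt a L.j) ∪ (match L.k with
    | none => ∅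
    | some k => if L.cap then (R ∪ C) ∩ cofibV F (lpt a k) else cofibV F (lpt a k))

/-- `LsetU` is an up-set. [this work] -/
theorem isUpperSet_LsetU (hF : IsUpperSet (F : Set (Pt (U ⊕ V)))) (hS' : IsUpperSet ((S ∪ B : Finset (Pt U)) : Set (Pt U)))
    (L : TwoBlock.LSpec) (b : LPerm V) : IsUpperSet ((LsetU S B F L b : Finset (Pt U)) : Set (Pt U)) := by
  unfold LsetU
  rcases L with ⟨j, _ | k, cap⟩
  · rw [coe_union, coe_empty, Set.union_empty]; exact isUpperSet_cofib hF _
  · cases cap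
    · rw [coe_union]; exact (isUpperSet_cofib hF _).union (isUpperSet_cofib hF _)
    · rw [coe_union]; simp only [ite_true]; rw [coe_inter]; exact (isUpperSet_cofib hF _).union (hS'.inter (isUpperSet_cofib hF _))

/-- `LsetV` is an up-set. [this work] -/
theorem isUpperSet_LsetV (hF : IsUpperSet (F : Set (Pt (U ⊕ V)))) (hR' : IsUpperSet ((R ∪ C : Finset (Pt V)) : Set (Pt V)))
    (L : TwoBlock.LSpec) (a : LPerm U) : IsUpperSet ((LsetV R C F L a : Finset (Pt V)) : Set (Pt V)) := by
  unfold LsetV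
  rcases L with ⟨j, _ | k, cap⟩
  · rw [coe_union, coe_empty, Set.union_empty]; exact isUpperSet_cofibV hF _
  · cases cap
    · rw [coe_union]; exact (isUpperSet_cofibV hF _).union (isUpperSet_cofibV hF _)
    · rw [coe_union]; simp only [ite_true]; rw [coe_inter]; exact (isUpperSet_cofibV hF _).union (hR'.inter (isUpperSet_cofibV hF _))

/-- `memL` of the configuration is the indicator of `LsetU`. [this work] -/
theorem memL_cfg (L : TwoBlock.LSpec) (ρ : LPerm (U ⊕ V)) (i : Fin 3) :
    TwoBlock.memL (cfg S B R C F ρ) L i = ind (LsetU S B F L (rV ρ)) (lpt (rU ρ) i) := by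
  unfold TwoBlock.memL TwoBlock.bi LsetU cfg utype mixPt
  rcases L with ⟨j, _ | k, cap⟩
  · by_cases h : Sum.elim (lpt (rU ρ) i) (lpt (rV ρ) j) ∈ F <;> simp [h]
  · cases cap
    · by_cases h : Sum.elim (lpt (rU ρ) i) (lpt (rV ρ) j) ∈ F <;> by_cases h' : Sum.elim (lpt (rU ρ) i) (lpt (rV ρ) k) ∈ F <;>
        simp [h, h']
    · by_cases h : Sum.elim (lpt (rU ρ) i) (lpt (rV ρ) j) ∈ F <;> by_cases h' : Sum.elim (lpt (rU ρ) i) (lpt (rV ρ) k) ∈ F <;>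
        by_cases h1 : lpt (rU ρ) i ∈ S <;> by_cases h2 : lpt (rU ρ) i ∈ B <;> simp [h, h', h1, h2]

/-- `memL` of the transposed configuration is the indicator of `LsetV`. [this work] -/
theorem memL_tr_cfg (L : TwoBlock.LSpec) (ρ : LPerm (U ⊕ V)) (j : Fin 3) :
    TwoBlock.memL (TwoBlock.tr (cfg S B R C F ρ)) L j = ind (LsetV R C F L (rU ρ)) (lpt (rV ρ) j) := by
  unfold TwoBlock.memL TwoBlock.bi TwoBlock.tr LsetV cfg vtype mixPt
  rcases L with ⟨i, _ | k, cap⟩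
  · by_cases h : Sum.elim (lpt (rU ρ) i) (lpt (rV ρ) j) ∈ F <;> simp [h]
  · cases cap
    · by_cases h : Sum.elim (lpt (rU ρ) i) (lpt (rV ρ) j) ∈ F <;> by_cases h' : Sum.elim (lpt (rU ρ) k) (lpt (rV ρ) j) ∈ F <;>
        simp [h, h']
    · by_cases h : Sum.elim (lpt (rU ρ) i) (lpt (rV ρ) j) ∈ F <;> by_cases h' : Sum.elim (lpt (rU ρ) k) (lpt (rV ρ) j) ∈ F <;>
        by_cases h1 : lpt (rV ρ) j ∈ R <;> by_cases h2 : lpt (rV ρ) j ∈ C <;> simp [h, h', h1, h2]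

/-- The conditioning key as a function of the third `U`-point and the `V`-component. [this work] -/
def keyOfU (z : Pt U) (b : LPerm V) : ℕ :=
  (utype S B z).val + 3 * (TwoBlock.bn (decide (Sum.elim z (lpt b 0) ∈ F)) + 2 * TwoBlock.bn (decide (Sum.elim z (lpt b 1) ∈ F))
    + 4 * TwoBlock.bn (decide (Sum.elim z (lpt b 2) ∈ F))) + 24 * ((vtype R C (lpt b 0)).val + 3 * (vtype R C (lpt b 1)).val + 9 * (vtype R C (lpt b 2)).val)

/-- The conditioning key of the transposed configuration as a function of the third `V`-point and the `U`-component. [this work] -/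
def keyOfV (z : Pt V) (a : LPerm U) : ℕ :=
  (vtype R C z).val + 3 * (TwoBlock.bn (decide (Sum.elim (lpt a 0) z ∈ F)) + 2 * TwoBlock.bn (decide (Sum.elim (lpt a 1) z ∈ F))
    + 4 * TwoBlock.bn (decide (Sum.elim (lpt a 2) z ∈ F))) + 24 * ((utype S B (lpt a 0)).val + 3 * (utype S B (lpt a 1)).val + 9 * (utype S B (lpt a 2)).val)

/-- `keyU` of the configuration. [this work] -/
theorem keyU_cfg (ρ : LPerm (U ⊕ V)) : TwoBlock.keyU (cfg S B R C F ρ) = keyOfU S B R C F (lpt (rU ρ) 2) (rV ρ) := rfl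

/-- `keyU` of the transposed configuration. [this work] -/
theorem keyU_tr_cfg (ρ : LPerm (U ⊕ V)) : TwoBlock.keyU (TwoBlock.tr (cfg S B R C F ρ)) = keyOfV S B R C F (lpt (rV ρ) 2) (rU ρ) := rfl

/-- A Latin sum of a list sum is the list sum of the Latin sums. [this work] -/
theorem sum_list_map_comm {α : Type} (l : List α) (g : LPerm (U ⊕ V) → α → ℤ) :
    ∑ ρ : LPerm (U ⊕ V), (l.map (g ρ)).sum = (l.map fun t => ∑ ρ : LPerm (U ⊕ V), g ρ t).sum := by
  induction l with
  | nil => simp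
  | cons a l ih => simp only [List.map_cons, List.sum_cons, sum_add_distrib, ih]

/-- **Every `U`-term of the certificate has a nonnegative Latin sum** (conditional Harris inside the `U`-block), hence so has `certUw`. [this work] -/
theorem sum_certUw_nonneg (hF : IsUpperSet (F : Set (Pt (U ⊕ V)))) (hS' : IsUpperSet ((S ∪ B : Finset (Pt U)) : Set (Pt U))) :
    0 ≤ ∑ ρ : LPerm (U ⊕ V), TwoBlock.certUw (cfg S B R C F ρ) := by
  unfold TwoBlock.certUw
  rw [sum_list_map_comm]
  refine List.sum_nonneg (fun x hx => ?_)
  rw [List.mem_map] at hx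
  obtain ⟨t, ht, rfl⟩ := hx
  have hlam : 0 ≤ t.2.1 := TwoBlock.termsU_nonneg t ht
  set μ : Pt U → LPerm V → ℤ := fun z b => if keyOfU S B R C F z b = t.1 then 1 else 0 with hμ
  have h := sum_lperm_condHarrisU hS' (LsetU S B F t.2.2) (isUpperSet_LsetU S B F hF hS' t.2.2) μ
    (fun z b => by rw [hμ]; dsimp only; split_ifs <;> norm_num)
  have e : ∀ ρ : LPerm (U ⊕ V), t.2.1 * ((if TwoBlock.keyU (cfg S B R C F ρ) = t.1 then 1 else 0) * TwoBlock.brU (cfg S B R C F ρ) t.2.2) =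
      t.2.1 * (μ (lpt (rU ρ) 2) (rV ρ) * (ind (S ∪ B) (lpt (rU ρ) 0) * ind (LsetU S B F t.2.2 (rV ρ)) (lpt (rU ρ) 0)))
        - t.2.1 * (μ (lpt (rU ρ) 2) (rV ρ) * (ind (S ∪ B) (lpt (rU ρ) 0) * ind (LsetU S B F t.2.2 (rV ρ)) (lpt (rU ρ) 1))) := by
    intro ρ; unfold TwoBlock.brU; rw [keyU_cfg, isSp_cfg, memL_cfg, memL_cfg, hμ]; ring
  rw [sum_congr rfl fun ρ _ => e ρ, sum_sub_distrib, ← mul_sum, ← mul_sum, ← mul_sub]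
  exact mul_nonneg hlam (by linarith)

/-- **Every `V`-term of the certificate has a nonnegative Latin sum**, hence so has `certVw`. [this work] -/
theorem sum_certVw_nonneg (hF : IsUpperSet (F : Set (Pt (U ⊕ V)))) (hR' : IsUpperSet ((R ∪ C : Finset (Pt V)) : Set (Pt V))) :
    0 ≤ ∑ ρ : LPerm (U ⊕ V), TwoBlock.certVw (cfg S B R C F ρ) := by
  unfold TwoBlock.certVw
  rw [sum_list_map_comm]
  refine List.sum_nonneg (fun x hx => ?_)
  rw [List.mem_map] at hx
  obtain ⟨t, ht, rfl⟩ := hx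
  have hlam : 0 ≤ t.2.1 := TwoBlock.termsV_nonneg t ht
  set μ : Pt V → LPerm U → ℤ := fun z a => if keyOfV S B R C F z a = t.1 then 1 else 0 with hμ
  have h := sum_lperm_condHarrisV hR' (LsetV R C F t.2.2) (isUpperSet_LsetV R C F hF hR' t.2.2) μ
    (fun z a => by rw [hμ]; dsimp only; split_ifs <;> norm_num)
  have e : ∀ ρ : LPerm (U ⊕ V), t.2.1 * ((if TwoBlock.keyU (TwoBlock.tr (cfg S B R C F ρ)) = t.1 then 1 else 0) * TwoBlock.brU (TwoBlock.tr (cfg S B R C F ρ)) t.2.2) =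
      t.2.1 * (μ (lpt (rV ρ) 2) (rU ρ) * (ind (R ∪ C) (lpt (rV ρ) 0) * ind (LsetV R C F t.2.2 (rU ρ)) (lpt (rV ρ) 0)))
        - t.2.1 * (μ (lpt (rV ρ) 2) (rU ρ) * (ind (R ∪ C) (lpt (rV ρ) 0) * ind (LsetV R C F t.2.2 (rU ρ)) (lpt (rV ρ) 1))) := by
    intro ρ; unfold TwoBlock.brU
    have e1 : TwoBlock.isSp (TwoBlock.tr (cfg S B R C F ρ)) 0 = ind (R ∪ C) (lpt (rV ρ) 0) := isRp_cfg S B F ρ 0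
    rw [keyU_tr_cfg, e1, memL_tr_cfg, memL_tr_cfg, hμ]; ring
  rw [sum_congr rfl fun ρ _ => e ρ, sum_sub_distrib, ← mul_sum, ← mul_sum, ← mul_sub]
  exact mul_nonneg hlam (by linarith)

/-- Left cylinders of up-sets are up-sets. [this work] -/
theorem isUpperSet_cylL' {X : Finset (Pt U)} (hX : IsUpperSet (X : Set (Pt U))) : IsUpperSet ((cylL X : Finset (Pt (U ⊕ V))) : Set (Pt (U ⊕ V))) := by
  intro u u' hle hu
  rw [mem_coe, mem_cylL] at hu ⊢
  exact hX (fun i => hle (Sum.inl i)) hu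

/-- Right cylinders of up-sets are up-sets. [this work] -/
theorem isUpperSet_cylR' {Y : Finset (Pt V)} (hY : IsUpperSet (Y : Set (Pt V))) : IsUpperSet ((cylR Y : Finset (Pt (U ⊕ V))) : Set (Pt (U ⊕ V))) := by
  intro u u' hle hu
  rw [mem_coe, mem_cylR] at hu ⊢
  exact hY (fun i => hle (Sum.inr i)) hu

/-- **The first joint term has a nonnegative Latin sum** (conditional Harris in the product). [this work] -/
theorem sum_termX1_nonneg (hF : IsUpperSet (F : Set (Pt (U ⊕ V)))) (hS' : IsUpperSet ((S ∪ B : Finset (Pt U)) : Set (Pt U)))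
    (hR' : IsUpperSet ((R ∪ C : Finset (Pt V)) : Set (Pt V))) : 0 ≤ ∑ ρ : LPerm (U ⊕ V), TwoBlock.termX1 (cfg S B R C F ρ) := by
  set μ : Pt (U ⊕ V) → ℤ := fun z => if utype S B (fstPt z) = 1 ∧ vtype R C (sndPt z) = 0 ∧ decide (z ∈ F) = true then 1 else 0 with hμ
  have hL : IsUpperSet ((F ∩ cylL (S ∪ B) : Finset (Pt (U ⊕ V))) : Set (Pt (U ⊕ V))) := by
    rw [coe_inter]; exact hF.inter (isUpperSet_cylL' hS')
  have h := sum_lperm_condHarris (isUpperSet_cylR' (U := U) hR') hL μ (fun z => by rw [hμ]; dsimp only; split_ifs <;> norm_num)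
  have e : ∀ ρ : LPerm (U ⊕ V), TwoBlock.termX1 (cfg S B R C F ρ) =
      μ (lpt ρ 2) * (ind (cylR (R ∪ C) : Finset (Pt (U ⊕ V))) (lpt ρ 0) * ind (F ∩ cylL (S ∪ B)) (lpt ρ 0))
        - μ (lpt ρ 2) * (ind (cylR (R ∪ C) : Finset (Pt (U ⊕ V))) (lpt ρ 0) * ind (F ∩ cylL (S ∪ B)) (lpt ρ 1)) := by
    intro ρ
    have eμ : μ (lpt ρ 2) = (if (cfg S B R C F ρ).1 2 = 1 ∧ (cfg S B R C F ρ).2.1 2 = 0 ∧ (cfg S B R C F ρ).2.2 2 2 = true then 1 else 0) := by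
      rw [hμ]; dsimp only [cfg, mixPt]; rw [lpt_eq_elim ρ 2, fstPt_elim, sndPt_elim]; try rfl
    unfold TwoBlock.termX1
    rw [← eμ, ind_inter, ind_inter, isRp_cfg, isSp_cfg, isSp_cfg, fF_cfg, fF_cfg, mixPt_diag, mixPt_diag, ind_cylR_lpt, ind_cylL_lpt,
      ind_cylL_lpt]
    ring
  rw [sum_congr rfl fun ρ _ => e ρ, sum_sub_distrib]
  linarith

/-- **The second joint term has a nonnegative Latin sum.** [this work] -/
theorem sum_termX2_nonneg (hF : IsUpperSet (F : Set (Pt (U ⊕ V)))) (hS' : IsUpperSet ((S ∪ B : Finset (Pt U)) : Set (Pt U)))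
    (hR' : IsUpperSet ((R ∪ C : Finset (Pt V)) : Set (Pt V))) : 0 ≤ ∑ ρ : LPerm (U ⊕ V), TwoBlock.termX2 (cfg S B R C F ρ) := by
  set μ : Pt (U ⊕ V) → ℤ := fun z => if utype S B (fstPt z) = 0 ∧ vtype R C (sndPt z) = 1 ∧ decide (z ∈ F) = true then 1 else 0 with hμ
  have hL : IsUpperSet ((F ∩ cylR (R ∪ C) : Finset (Pt (U ⊕ V))) : Set (Pt (U ⊕ V))) := by
    rw [coe_inter]; exact hF.inter (isUpperSet_cylR' hR')
  have h := sum_lperm_condHarris (isUpperSet_cylL' (V := V) hS') hL μ (fun z => by rw [hμ]; dsimp only; split_ifs <;> norm_num)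
  have e : ∀ ρ : LPerm (U ⊕ V), TwoBlock.termX2 (cfg S B R C F ρ) =
      μ (lpt ρ 2) * (ind (cylL (S ∪ B) : Finset (Pt (U ⊕ V))) (lpt ρ 0) * ind (F ∩ cylR (R ∪ C)) (lpt ρ 0))
        - μ (lpt ρ 2) * (ind (cylL (S ∪ B) : Finset (Pt (U ⊕ V))) (lpt ρ 0) * ind (F ∩ cylR (R ∪ C)) (lpt ρ 1)) := by
    intro ρ
    have eμ : μ (lpt ρ 2) = (if (cfg S B R C F ρ).1 2 = 0 ∧ (cfg S B R C F ρ).2.1 2 = 1 ∧ (cfg S B R C F ρ).2.2 2 2 = true then 1 else 0) := by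
      rw [hμ]; dsimp only [cfg, mixPt]; rw [lpt_eq_elim ρ 2, fstPt_elim, sndPt_elim]; try rfl
    unfold TwoBlock.termX2
    rw [← eμ, ind_inter, ind_inter, isSp_cfg, isRp_cfg, isRp_cfg, fF_cfg, fF_cfg, mixPt_diag, mixPt_diag, ind_cylL_lpt, ind_cylR_lpt,
      ind_cylR_lpt]
    ring
  rw [sum_congr rfl fun ρ _ => e ρ, sum_sub_distrib]
  linarith

/-! ## §4  The theorem -/

/-- **THE TWO-BLOCK ZERO-BOTTOM THEOREM**: `Ψ(F; S×Ω, B×Ω, Ω×R, Ω×C) ≥ 0` for disjoint `S, B` with `S ∪ B` an up-set of `[3]^U`, disjoint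
`R, C` with `R ∪ C` an up-set of `[3]^V`, and every up-set `F ⊇ S×Ω ∪ Ω×R` of `[3]^{U ⊕ V}`. [this work] -/
theorem psi_nonneg_twoBlock (hSB : Disjoint S B) (hRC : Disjoint R C) (hS' : IsUpperSet ((S ∪ B : Finset (Pt U)) : Set (Pt U)))
    (hR' : IsUpperSet ((R ∪ C : Finset (Pt V)) : Set (Pt V))) (hF : IsUpperSet (F : Set (Pt (U ⊕ V))))
    (hSF : (cylL S : Finset (Pt (U ⊕ V))) ⊆ F) (hRF : (cylR R : Finset (Pt (U ⊕ V))) ⊆ F) :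
    0 ≤ Psi F (cylL S : Finset (Pt (U ⊕ V))) (cylL B) (cylR R) (cylR C) := by
  -- Ψ as a sum of psiA over configurations
  have e1 : Psi F (cylL S : Finset (Pt (U ⊕ V))) (cylL B) (cylR R) (cylR C) = ∑ ρ : LPerm (U ⊕ V), TwoBlock.psiA (cfg S B R C F ρ) := by
    rw [Psi_eq_sum_lperm]; exact sum_congr rfl fun ρ _ => (psiA_cfg S B R C F hSB hRC ρ).symm
  -- the certificate part is nonnegative
  have hU := sum_certUw_nonneg S B R C F hF hS'
  have hV := sum_certVw_nonneg S B R C F hF hR'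
  have hX1 := sum_termX1_nonneg S B R C F hF hS' hR'
  have hX2 := sum_termX2_nonneg S B R C F hF hS' hR'
  have hcert : 0 ≤ ∑ ρ : LPerm (U ⊕ V), (TwoBlock.certUf (cfg S B R C F ρ) + TwoBlock.certVf (cfg S B R C F ρ)
      + TwoBlock.termX1 (cfg S B R C F ρ) + TwoBlock.termX2 (cfg S B R C F ρ)) := by
    simp only [TwoBlock.certUf_eq, TwoBlock.certVf_eq, sum_add_distrib]
    linarith
  -- the symmetrised remainder is pointwise nonnegative
  have hphi : 0 ≤ 36 * ∑ ρ : LPerm (U ⊕ V), TwoBlock.phi (cfg S B R C F ρ) := by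
    rw [← sum_lperm_sym36 (fun ρ => TwoBlock.phi (cfg S B R C F ρ))]
    refine sum_nonneg fun ρ _ => ?_
    have h := TwoBlock.phi36_nonneg (cfg S B R C F ρ) (adm_cfg S B R C F hSF hRF ρ)
    unfold TwoBlock.phi36 at h
    simpa only [← cfg_mul_cst2] using h
  have e2 : ∑ ρ : LPerm (U ⊕ V), TwoBlock.psiA (cfg S B R C F ρ) =
      ∑ ρ : LPerm (U ⊕ V), TwoBlock.phi (cfg S B R C F ρ) + ∑ ρ : LPerm (U ⊕ V), (TwoBlock.certUf (cfg S B R C F ρ)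
        + TwoBlock.certVf (cfg S B R C F ρ) + TwoBlock.termX1 (cfg S B R C F ρ) + TwoBlock.termX2 (cfg S B R C F ρ)) := by
    rw [← sum_add_distrib]; exact sum_congr rfl fun ρ _ => by unfold TwoBlock.phi; ring
  rw [e1, e2]
  linarith

/-- **TOP-SLICE DOMINANCE WITH THE SHARP CONSTANT `3/2` FOR TWO ARBITRARY PRIME/CUT PAIRS ON DISJOINT BLOCKS** (every dimension): with
`P = S×Ω ⊆ P′ = (S∪B)×Ω`, `Q = Ω×R ⊆ Q′ = Ω×(R∪C)` and any up-set `F ⊇ P ∪ Q`,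
`3·κ(F, P′, Q′) ≤ 2·κ(ofSections F F F, ofSections P P P′, ofSections Q Q Q′)` — `4c₁ ≥ 3c₃`. [this work] -/
theorem three_kappa_top_le_two_kappa_lowerStep_twoBlock (hSB : Disjoint S B) (hRC : Disjoint R C)
    (hS' : IsUpperSet ((S ∪ B : Finset (Pt U)) : Set (Pt U))) (hR' : IsUpperSet ((R ∪ C : Finset (Pt V)) : Set (Pt V)))
    (hF : IsUpperSet (F : Set (Pt (U ⊕ V)))) (hSF : (cylL S : Finset (Pt (U ⊕ V))) ⊆ F) (hRF : (cylR R : Finset (Pt (U ⊕ V))) ⊆ F) :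
    3 * kappa F ((cylL S : Finset (Pt (U ⊕ V))) ∪ cylL B) ((cylR R : Finset (Pt (U ⊕ V))) ∪ cylR C) ≤
      2 * kappa (ofSections F F F) (ofSections (cylL S) (cylL S) ((cylL S : Finset (Pt (U ⊕ V))) ∪ cylL B))
        (ofSections (cylR R) (cylR R) ((cylR R : Finset (Pt (U ⊕ V))) ∪ cylR C)) := by
  have hI : Indep (cylL S : Finset (Pt (U ⊕ V))) (cylR R) := indep_cylL_cylR S R
  have h0 : kappa F (cylL S : Finset (Pt (U ⊕ V))) (cylR R) = 0 := kappa_eq_zero_of_indep_of_union_subset hI (union_subset hSF hRF)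
  have hb : ((cylL S : Finset (Pt (U ⊕ V))) ∪ cylL B) \ cylL S = cylL B := by
    rw [union_sdiff_left, Finset.sdiff_eq_self_iff_disjoint]; exact (disjoint_cylL_of_disjoint hSB).symm
  have hc : ((cylR R : Finset (Pt (U ⊕ V))) ∪ cylR C) \ cylR R = cylR C := by
    rw [union_sdiff_left, Finset.sdiff_eq_self_iff_disjoint]; exact (disjoint_cylR hRC).symm
  have key := (three_kappa_top_le_iff_psi_nonneg (F := F) (subset_union_left (s₁ := (cylL S : Finset (Pt (U ⊕ V)))) (s₂ := cylL B))
    (subset_union_left (s₁ := (cylR R : Finset (Pt (U ⊕ V)))) (s₂ := cylR C)) h0).2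
  rw [hb, hc] at key
  exact key (psi_nonneg_twoBlock S B R C F hSB hRC hS' hR' hF hSF hRF)

end twoblock

end Summit.CriticalPhenomena.PercolationContinuityZ3.Theorems.SahiLatin
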